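import Summits.RiemannHypothesis.RiemannHypothesis.Theorems.SignConeExactConeRigidityCone
import HarnessLib

/-!
# Route SignCone, item `ExactConeRigidity` (stmt-RiemannHypothesis-16306): conic duality at a
cutoff, and the reduction of the exact chain to `ConeMagnification`

* `signCone_conicDuality κ` — at a cutoff `a > 0`: if every node-nonnegative family sum `F ∈ P(a)`
  (finite sums of autocorrelations `g_i ⋆ g̃_i` of Weil tests supported in `[-a, a]`, with
  `Re F(log n) ≥ 0` for all `n ≥ 2`) has `-κ Re F(0) ≤ Re W_ar(F)`, `W_ar = weilPolarTerm +
  weilArchTerm`, then there is a weight `c : ℕ → ℝ`, `c ≥ 0`, `c 1 = 0`, with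
  `-κ ∫|g|² ≤ Re [W_ar(g ⋆ g̃) − Σ_n c(n) n^{-1/2} ((g ⋆ g̃)(log n) + (g ⋆ g̃)(−log n))]` for every
  Weil test `g` supported in `[-a, a]`. Proof: the image of `P(a)` under
  `F ↦ (Re W_ar F + κ Re F(0), (Re F(log n))_{2 ≤ n, log n < 2a})` is a convex cone (concatenation
  of families, `√r`-scaling, linearity of `W_ar`), the sign-cone hypothesis is positivity of the
  first coordinate on the nonnegative orthant of the others, the Slater point is the bump of
  `exists_slater_bump`; `finiteCone_duality` gives the weights, and `G(0) = ∫|g|²`,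
  `Re G(−log n) = Re G(log n)` translate back (toolkit: `SignConeExactConeRigidityCone.lean`).
* `ExactConeRigidity_of_coneMagnification` — `ConeMagnification → ExactConeRigidity`: with `κ = 0`
  the exact sign-cone inequality at cutoff `a` yields a nonnegative integer-supported weight whose
  fake Weil form `W_ar − P_c` is `≥ 0 ≥ −‖g‖₂²` on the Weil tests of the window, which is the
  hypothesis of the route's crux `ConeMagnification` at `a`. So the exact chain (item
  stmt-RiemannHypothesis-16306) is reduced to the magnification crux (stmt-RiemannHypothesis-16303);
  the remaining 2001 route to it (compactness of the exact cones and rigidity `K = {Λ}` via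
  W-COMP/W-SRPP) is not formalised here.
* The case `κ = 1` of `signCone_conicDuality` is, after `one_mul`, literally the route's crux
  `SignConeDuality` (stmt-RiemannHypothesis-16304, which has its own line `Cruxes/SignConeDuality`;
  not restated here).

The route items are stated over Mathlib primitives, definitionally equal to the Literature forms
used in the proofs (route file, CONE NOTE). Sources: archive 2001 fefr Thm 7.2 (conic duality at a
cutoff); Shapiro 2001; Bombieri 2000 (Weil's functional).
-/

noncomputable section

open Complex Filter Set MeasureTheory
open scoped Real Topology ComplexConjugate ContDiff

namespace Summit.RiemannHypothesis.RiemannHypothesis.Theorems.SignConeExactConeRigidity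

open Literature.NumberTheory.LFunctions

variable {a : ℝ}

/-! ## Conic duality at a cutoff -/

/-- **Conic duality at a cutoff** (slack `κ`; archive 2001 fefr Thm 7.2 / this route's cruxes
`SignConeDuality` (`κ = 1`) and `ExactConeRigidity` (`κ = 0`)). Fix `a > 0` and suppose that for
every finite family `g_i` of Weil tests supported in `[-a, a]` whose sum of autocorrelations
`F = Σ_i g_i ⋆ g̃_i` is nonnegative at the integer nodes, `Re F(log n) ≥ 0` (`n ≥ 2`), one has
`-κ Re F(0) ≤ Re W_ar(F)`, `W_ar = weilPolarTerm + weilArchTerm`. Then there is a nonnegative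
weight `c` on `ℕ` with `c 1 = 0` (supported on `2 ≤ n < e^{2a}`) such that for every Weil test `g`
supported in `[-a, a]`, with `G = g ⋆ g̃`,
`-κ ∫|g|² ≤ Re [W_ar(G) − Σ_n c(n) n^{-1/2} (G(log n) + G(−log n))]`.
Proof: `finiteCone_duality` for the image cone of `P(a)` in `ℝ × ℝ^S`,
`S = {n : 2 ≤ n, log n < 2a}` (nodes with `log n ≥ 2a` carry `F(log n) = 0`,
`familySum_eq_zero_of_le_abs`), Slater point `exists_slater_bump`; then `G(0) = ∫|g|²`
(`weilConv_weilReflect_apply_zero`) and `Re G(−log n) = Re G(log n)`. -/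
theorem signCone_conicDuality (κ : ℝ) (ha : 0 < a)
    (hP : ∀ (k : ℕ) (g : Fin k → ℝ → ℂ),
      (∀ i, IsWeilTest (g i) ∧ tsupport (g i) ⊆ Icc (-a) a) →
      (∀ n : ℕ, 2 ≤ n → 0 ≤ (∑ i, weilConv (g i) (weilReflect (g i)) (Real.log n)).re) →
      -(κ * (∑ i, weilConv (g i) (weilReflect (g i)) 0).re) ≤
        (weilPolarTerm (fun t ↦ ∑ i, weilConv (g i) (weilReflect (g i)) t) +
          weilArchTerm (fun t ↦ ∑ i, weilConv (g i) (weilReflect (g i)) t)).re) :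
    ∃ c : ℕ → ℝ, (∀ n, 0 ≤ c n) ∧ c 1 = 0 ∧ ∀ g : ℝ → ℂ, IsWeilTest g →
      tsupport g ⊆ Icc (-a) a →
      -(κ * ∫ t, ‖g t‖ ^ 2) ≤
        (weilPolarTerm (weilConv g (weilReflect g)) + weilArchTerm (weilConv g (weilReflect g)) -
          ∑' n : ℕ, ((c n : ℝ) : ℂ) / (Real.sqrt n : ℂ) *
            (weilConv g (weilReflect g) (Real.log n) +
              weilConv g (weilReflect g) (-Real.log n))).re := by
  classical
  -- the finite node set `S = {n : 2 ≤ n, log n < 2a}`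
  set S : Finset ℕ := (Finset.range (⌊Real.exp (2 * a)⌋₊ + 1)).filter
    (fun n ↦ 2 ≤ n ∧ Real.log n < 2 * a) with hS_def
  have hS : ∀ n : ℕ, n ∈ S ↔ 2 ≤ n ∧ Real.log n < 2 * a := by
    intro n
    simp only [hS_def, Finset.mem_filter, Finset.mem_range, and_iff_right_iff_imp, and_imp]
    intro h2 hlog
    have hn : (0 : ℝ) < n := by positivity
    have h' : (n : ℝ) < Real.exp (2 * a) := by rwa [Real.log_lt_iff_lt_exp hn] at hlog
    have := Nat.le_floor h'.le
    omega
  -- the image cone of `P(a)`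
  set C : Set (ℝ × (S → ℝ)) := {p | ∃ (k : ℕ) (g : Fin k → ℝ → ℂ),
    (∀ i, IsWeilTest (g i) ∧ tsupport (g i) ⊆ Icc (-a) a) ∧
      p = ((weilPolarTerm (fun t ↦ ∑ i, weilConv (g i) (weilReflect (g i)) t) +
            weilArchTerm (fun t ↦ ∑ i, weilConv (g i) (weilReflect (g i)) t)).re +
            κ * (∑ i, weilConv (g i) (weilReflect (g i)) 0).re,
          fun n : S ↦ (∑ i, weilConv (g i) (weilReflect (g i)) (Real.log n)).re)} with hC_def
  -- (C0) the empty family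
  have hC0 : (0 : ℝ × (S → ℝ)) ∈ C := by
    refine ⟨0, fun i ↦ Fin.elim0 i, fun i ↦ Fin.elim0 i, ?_⟩
    ext n
    · simp only [Prod.fst_zero, Finset.univ_eq_empty, Finset.sum_empty, Complex.zero_re,
        mul_zero, add_zero]
      rw [polarArch_zero, Complex.zero_re]
    · simp
  -- (C+) concatenation of families
  have hCadd : ∀ p ∈ C, ∀ q ∈ C, p + q ∈ C := by
    rintro p ⟨k, g, hg, rfl⟩ q ⟨k', g', hg', rfl⟩
    refine ⟨k + k', Fin.append g g', window_append hg hg', ?_⟩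
    have hF := isWeilTest_familySum hg
    have hF' := isWeilTest_familySum hg'
    ext n
    · simp only [Prod.fst_add]
      rw [familySum_append g g', polarArch_add hF hF', Complex.add_re]
      simp only [Fin.sum_univ_add, Fin.append_left, Fin.append_right, Complex.add_re]
      ring
    · simp only [Prod.snd_add, Pi.add_apply, Fin.sum_univ_add, Fin.append_left,
        Fin.append_right, Complex.add_re]
  -- (C•) scaling by `r ≥ 0`
  have hCsmul : ∀ r : ℝ, 0 ≤ r → ∀ p ∈ C, r • p ∈ C := by
    rintro r hr p ⟨k, g, hg, rfl⟩
    refine ⟨k, fun i u ↦ (Real.sqrt r : ℂ) * g i u,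
      fun i ↦ ⟨isWeilTest_const_mul _ (hg i).1, tsupport_mul_subset_right.trans (hg i).2⟩, ?_⟩
    have hfun := familySum_sqrt_mul g r hr
    have h0 := congrFun hfun 0
    ext n
    · simp only [Prod.smul_fst, smul_eq_mul]
      rw [hfun, polarArch_const_mul, h0, Complex.re_ofReal_mul, Complex.re_ofReal_mul]
      ring
    · have hn := congrFun hfun (Real.log n)
      simp only [Prod.smul_snd, Pi.smul_apply, smul_eq_mul]
      rw [hn, Complex.re_ofReal_mul]
  -- (P) the sign-cone inequality on the cone
  have hCpos : ∀ p ∈ C, (∀ n, 0 ≤ p.2 n) → 0 ≤ p.1 := by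
    rintro p ⟨k, g, hg, rfl⟩ hnn
    have h := hP k g hg (fun n hn2 ↦ ?_)
    · dsimp only
      linarith
    · by_cases hlog : Real.log n < 2 * a
      · exact hnn ⟨n, (hS n).2 ⟨hn2, hlog⟩⟩
      · rw [familySum_eq_zero_of_le_abs hg (le_abs.2 (Or.inl (not_lt.1 hlog))),
          Complex.zero_re]
  -- (Sl) the Slater point
  have hCslater : ∃ p ∈ C, ∀ n, 1 ≤ p.2 n := by
    obtain ⟨φ, hφ, hφsupp, hφpos⟩ := exists_slater_bump ha
    set p₀ : ℝ × (S → ℝ) :=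
      ((weilPolarTerm (fun t ↦ ∑ _i : Fin 1, weilConv φ (weilReflect φ) t) +
            weilArchTerm (fun t ↦ ∑ _i : Fin 1, weilConv φ (weilReflect φ) t)).re +
            κ * (∑ _i : Fin 1, weilConv φ (weilReflect φ) 0).re,
        fun n : S ↦ (∑ _i : Fin 1, weilConv φ (weilReflect φ) (Real.log n)).re) with hp₀_def
    have hp₀C : p₀ ∈ C := ⟨1, fun _ ↦ φ, fun _ ↦ ⟨hφ, hφsupp⟩, rfl⟩
    have hp₀pos : ∀ n : S, 0 < p₀.2 n := by
      rintro ⟨n, hn⟩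
      obtain ⟨hn2, hlog⟩ := (hS n).1 hn
      have hlog0 : 0 ≤ Real.log n := Real.log_nonneg (by exact_mod_cast (by omega : 1 ≤ n))
      simp only [hp₀_def, Finset.univ_unique, Fin.default_eq_zero, Finset.sum_singleton]
      exact hφpos _ (by rwa [abs_of_nonneg hlog0])
    rcases isEmpty_or_nonempty S with hSe | hSne
    · exact ⟨0, hC0, fun n ↦ isEmptyElim n⟩
    · obtain ⟨n₀, -, hmin⟩ :=
        Finset.exists_min_image Finset.univ (fun n : S ↦ p₀.2 n) Finset.univ_nonempty
      have hζ : 0 < p₀.2 n₀ := hp₀pos n₀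
      refine ⟨(1 / p₀.2 n₀) • p₀, hCsmul _ (by positivity) p₀ hp₀C, fun n ↦ ?_⟩
      simp only [Prod.smul_snd, Pi.smul_apply, smul_eq_mul]
      rw [one_div, ← div_eq_inv_mul, le_div_iff₀ hζ, one_mul]
      exact hmin n (Finset.mem_univ n)
  -- duality
  obtain ⟨c', hc'0, hc'⟩ := finiteCone_duality hC0 hCadd hCsmul hCpos hCslater
  -- the weight on `ℕ`
  set c : ℕ → ℝ := fun n ↦ if h : n ∈ S then c' ⟨n, h⟩ * Real.sqrt n / 2 else 0 with hc_def
  have hc0 : ∀ n, 0 ≤ c n := fun n ↦ by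
    simp only [hc_def]
    split_ifs with h
    · exact div_nonneg (mul_nonneg (hc'0 _) (Real.sqrt_nonneg _)) zero_le_two
    · exact le_rfl
  have hc1 : c 1 = 0 := by
    have : (1 : ℕ) ∉ S := fun h ↦ by have := ((hS 1).1 h).1; omega
    simp [hc_def, this]
  refine ⟨c, hc0, hc1, fun g hg hsupp ↦ ?_⟩
  -- the family `(g)` and its point of `C`
  set G : ℝ → ℂ := weilConv g (weilReflect g) with hG_def
  have hpC : ((weilPolarTerm (fun t ↦ ∑ _i : Fin 1, G t) +
      weilArchTerm (fun t ↦ ∑ _i : Fin 1, G t)).re + κ * (∑ _i : Fin 1, G 0).re,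
      fun n : S ↦ (∑ _i : Fin 1, G (Real.log n)).re) ∈ C :=
    ⟨1, fun _ ↦ g, fun _ ↦ ⟨hg, hsupp⟩, rfl⟩
  have hineq := hc' _ hpC
  simp only [Finset.univ_unique, Fin.default_eq_zero, Finset.sum_singleton] at hineq
  -- `hineq : ∑ n, c' n * (G (log n)).re ≤ (W_ar G).re + κ * (G 0).re`
  have hG0 : (G 0).re = ∫ t, ‖g t‖ ^ 2 := by
    rw [hG_def, weilConv_weilReflect_apply_zero, Complex.ofReal_re]
  -- the weighted node sum is a finite sum over `S`
  have hterm : ∀ n : ℕ, n ∈ S →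
      (((c n : ℝ) : ℂ) / (Real.sqrt n : ℂ) * (G (Real.log n) + G (-Real.log n))).re =
        (if h : n ∈ S then c' ⟨n, h⟩ else 0) * (G (Real.log n)).re := by
    intro n hn
    obtain ⟨hn2, -⟩ := (hS n).1 hn
    have hsq : 0 < Real.sqrt n := Real.sqrt_pos.2 (by positivity)
    rw [← Complex.ofReal_div, Complex.re_ofReal_mul, Complex.add_re, weilConv_weilReflect_neg_re,
      hc_def]
    simp only [hn, dif_pos]
    field_simp
    ring
  have htsum : (∑' n : ℕ, ((c n : ℝ) : ℂ) / (Real.sqrt n : ℂ) *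
      (G (Real.log n) + G (-Real.log n))).re = ∑ n : S, c' n * (G (Real.log n)).re := by
    rw [tsum_eq_sum (s := S) (fun n hn ↦ by simp [hc_def, hn]), Complex.re_sum,
      ← Finset.sum_coe_sort S]
    refine Finset.sum_congr rfl fun n _ ↦ ?_
    rw [hterm n n.2]
    simp only [n.2, dif_pos]
  rw [Complex.sub_re, htsum]
  have hW : (weilPolarTerm (fun t ↦ G t) + weilArchTerm (fun t ↦ G t)).re =
      (weilPolarTerm G + weilArchTerm G).re := rfl
  rw [hW] at hineq
  rw [hG0] at hineq
  linarith

/-! ## The route items -/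

/-- **`ConeMagnification → ExactConeRigidity`** (route SignCone, item stmt-RiemannHypothesis-16306
reduced to the crux stmt-RiemannHypothesis-16303). If the exact sign-cone inequality holds at every
cutoff, `signCone_conicDuality 0` produces at each cutoff `a` a nonnegative integer-supported
weight `c_a` (`c_a 1 = 0`) whose fake Weil form is `≥ 0 ≥ -‖g‖₂²` on the Weil tests of the window
`[-a, a]`; magnification on the slack cones (`ConeMagnification`) then gives the Riemann
hypothesis. The statements are the route's Mathlib-primitive forms, definitionally the Literature
forms used in the proof. -/
theorem ExactConeRigidity_of_coneMagnification
    (hmag : Theses.SignCone.ConeMagnification) : Theses.SignCone.ExactConeRigidity := by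
  intro hexact
  refine hmag fun a ha ↦ ?_
  have hP : ∀ (k : ℕ) (g : Fin k → ℝ → ℂ),
      (∀ i, IsWeilTest (g i) ∧ tsupport (g i) ⊆ Icc (-a) a) →
      (∀ n : ℕ, 2 ≤ n → 0 ≤ (∑ i, weilConv (g i) (weilReflect (g i)) (Real.log n)).re) →
      -((0 : ℝ) * (∑ i, weilConv (g i) (weilReflect (g i)) 0).re) ≤
        (weilPolarTerm (fun t ↦ ∑ i, weilConv (g i) (weilReflect (g i)) t) +
          weilArchTerm (fun t ↦ ∑ i, weilConv (g i) (weilReflect (g i)) t)).re := by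
    intro k g hg hnodes
    rw [zero_mul, neg_zero]
    exact hexact a ha k g hg hnodes
  obtain ⟨c, hc0, hc1, hc⟩ := signCone_conicDuality 0 ha hP
  refine ⟨c, hc0, hc1, fun g hg hsupp ↦ ?_⟩
  have h := hc g hg hsupp
  rw [zero_mul, neg_zero] at h
  have hnn : 0 ≤ ∫ t, ‖g t‖ ^ 2 := integral_nonneg fun t ↦ by positivity
  exact (neg_nonpos.2 hnn).trans h

end Summit.RiemannHypothesis.RiemannHypothesis.Theorems.SignConeExactConeRigidity
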